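import Summits.Ventures.Crystal3D.Theorems.StickyWulffConstantPolycrystalWulffBoundMinkowskiContent

/-!
# `PolycrystalWulffBound`, rung `rung_basalLamellar` — step 2d': the Minkowski-content bound from an
# arrangement package whose covering property is only required for `r ≤ 1`

Route `StickyWulffConstant` of the venture `Summits/Ventures/Crystal3D`, second prover lane (poly-p2,
gen 3).  Same statement and proof as `volume_chimera_le_of_package` (`…MinkowskiContent`), with the
COVERING hypothesis restricted to radii `0 < r ≤ 1` — the form delivered by the texture package, whose
bounding box has a fixed margin (`volume_chimera_le_of_package_local`).
WHAT THIS IS NOT: new mathematics.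
-/

noncomputable section

open scoped BigOperators InnerProductSpace ENNReal Pointwise Topology
open MeasureTheory Set Filter

namespace Summit.Ventures.Crystal3D.Theorems

set_option maxHeartbeats 400000 in
/-- **Minkowski content from a package with covering for `r ≤ 1`.**  See the module docstring. -/
theorem volume_chimera_le_of_package_local {k n : ℕ}
    (H : Fin k → Finset ((EuclideanSpace ℝ (Fin 3)) × ℝ))
    (hne : ∀ j, (⋂ q ∈ H j, {x : EuclideanSpace ℝ (Fin 3) | ⟪q.1, x⟫_ℝ < q.2}).Nonempty)
    (hbd : ∀ j, Bornology.IsBounded (⋂ q ∈ H j, {x : EuclideanSpace ℝ (Fin 3) | ⟪q.1, x⟫_ℝ < q.2}))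
    (hunit : ∀ j, ∀ q ∈ H j, ‖q.1‖ = 1)
    (S : Fin n → Finset (Fin k)) (K : Fin n → Set (EuclideanSpace ℝ (Fin 3))) {R : ℝ} (hR : 0 ≤ R)
(hK0 : ∀ f, (0 : EuclideanSpace ℝ (Fin 3)) ∈ K f)
    (hKR : ∀ f, K f ⊆ Metric.closedBall 0 R)
    (gr : Fin k → Fin n) (Adj : Finset (Fin k × Fin k))
    (q₀ : Fin k × Fin k → (EuclideanSpace ℝ (Fin 3)) × ℝ) (hAdj : ∀ t ∈ Adj, q₀ t ∈ H t.2)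
    (Pairs : Finset (((EuclideanSpace ℝ (Fin 3)) × ℝ) × ((EuclideanSpace ℝ (Fin 3)) × ℝ)))
    (hPairs : ∀ pp ∈ Pairs, ‖pp.1.1‖ = 1 ∧ ‖pp.2.1‖ = 1 ∧
      {x : EuclideanSpace ℝ (Fin 3) | ⟪pp.1.1, x⟫_ℝ = pp.1.2} ≠ {x | ⟪pp.2.1, x⟫_ℝ = pp.2.2})
    (N : Set (EuclideanSpace ℝ (Fin 3))) (hN : volume N = 0)
    (hcover : ∀ r : ℝ, 0 < r → r ≤ 1 → ∀ f, ∀ a ∈ S f,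
      ∀ q ∈ (⋂ q' ∈ H a, {x : EuclideanSpace ℝ (Fin 3) | ⟪q'.1, x⟫_ℝ < q'.2}), ∀ w ∈ K f,
      q + r • w ∉ (⋃ g, ⋃ a' ∈ S g, ⋂ q' ∈ H a', {x : EuclideanSpace ℝ (Fin 3) | ⟪q'.1, x⟫_ℝ < q'.2}) →
      q + r • w ∉ N →
      (∃ t ∈ Adj, gr t.1 = f ∧ q + r • w ∈ (⋂ q' ∈ H t.2, {x : EuclideanSpace ℝ (Fin 3) | ⟪q'.1, x⟫_ℝ < q'.2}) ∧
        (q₀ t).2 - r * sSup ((fun y => ⟪y, -(q₀ t).1⟫_ℝ) '' K f) < ⟪(q₀ t).1, q + r • w⟫_ℝ) ∨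
      (∃ pp ∈ Pairs, |⟪pp.1.1, q + r • w⟫_ℝ - pp.1.2| ≤ r * R ∧ |⟪pp.2.1, q + r • w⟫_ℝ - pp.2.2| ≤ r * R))
    {ε : ℝ} (hε : 0 < ε) :
    ∃ r₀ : ℝ, 0 < r₀ ∧ ∀ r : ℝ, 0 < r → r < r₀ →
      (volume (⋃ f, ⋃ a ∈ S f, ⋃ q ∈ (⋂ q' ∈ H a, {x : EuclideanSpace ℝ (Fin 3) | ⟪q'.1, x⟫_ℝ < q'.2}),
        q +ᵥ (r • K f))).toReal ≤
      (volume (⋃ f, ⋃ a ∈ S f, ⋂ q' ∈ H a, {x : EuclideanSpace ℝ (Fin 3) | ⟪q'.1, x⟫_ℝ < q'.2})).toReal +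
        r * ((∑ t ∈ Adj, sSup ((fun y => ⟪y, -(q₀ t).1⟫_ℝ) '' K (gr t.1)) *
          (volume {x : EuclideanSpace ℝ (Fin 3) | ∃ y ∈ closure (⋂ q' ∈ H t.2,
              {x : EuclideanSpace ℝ (Fin 3) | ⟪q'.1, x⟫_ℝ < q'.2}) ∩ {x | ⟪(q₀ t).1, x⟫_ℝ = (q₀ t).2},
            ∃ s ∈ Set.Icc (0 : ℝ) 1, x = y + s • (q₀ t).1}).toReal) + ε) := by
  classical
  -- abbreviations
  set Q : Fin k → Set (EuclideanSpace ℝ (Fin 3)) := fun j =>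
    ⋂ q' ∈ H j, {x : EuclideanSpace ℝ (Fin 3) | ⟪q'.1, x⟫_ℝ < q'.2} with hQ
  set E' : Set (EuclideanSpace ℝ (Fin 3)) := ⋃ f, ⋃ a ∈ S f, Q a with hE'
  set hK : Fin k × Fin k → ℝ := fun t =>
    sSup ((fun y => ⟪y, -(q₀ t).1⟫_ℝ) '' K (gr t.1)) with hhK
  set fA : Fin k × Fin k → ℝ := fun t =>
    (volume {x : EuclideanSpace ℝ (Fin 3) | ∃ y ∈ closure (Q t.2) ∩ {x | ⟪(q₀ t).1, x⟫_ℝ = (q₀ t).2},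
      ∃ s ∈ Set.Icc (0 : ℝ) 1, x = y + s • (q₀ t).1}).toReal with hfA
  -- support values are between `0` and `R`
  have hKbdd : ∀ f (v : EuclideanSpace ℝ (Fin 3)), BddAbove ((fun y => ⟪y, v⟫_ℝ) '' K f) := by
    intro f v
    refine ⟨R * ‖v‖, ?_⟩
    rintro _ ⟨y, hy, rfl⟩
    calc ⟪y, v⟫_ℝ ≤ ‖y‖ * ‖v‖ := real_inner_le_norm _ _
      _ ≤ R * ‖v‖ := by gcongr; exact mem_closedBall_zero_iff.1 (hKR f hy)
  have hhK0 : ∀ t, 0 ≤ hK t := fun t =>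
    le_csSup_of_le (hKbdd (gr t.1) _) ⟨0, hK0 (gr t.1), rfl⟩ (by
      show (0 : ℝ) ≤ ⟪(0 : EuclideanSpace ℝ (Fin 3)), -(q₀ t).1⟫_ℝ
      rw [inner_zero_left])
  have hhKR : ∀ t ∈ Adj, hK t ≤ R := by
    intro t ht
    refine csSup_le ((Set.image_nonempty).2 ⟨0, hK0 (gr t.1)⟩) ?_
    rintro _ ⟨y, hy, rfl⟩
    have hn : ‖-(q₀ t).1‖ = 1 := by rw [norm_neg]; exact hunit _ _ (hAdj t ht)
    calc ⟪y, -(q₀ t).1⟫_ℝ ≤ ‖y‖ * ‖-(q₀ t).1‖ := real_inner_le_norm _ _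
      _ ≤ R * 1 := by rw [hn]; gcongr; exact mem_closedBall_zero_iff.1 (hKR _ hy)
      _ = R := mul_one R
  have hfA0 : ∀ t, 0 ≤ fA t := fun t => ENNReal.toReal_nonneg
  -- a common ball for all cells
  have hball : ∃ RQ : ℝ, 0 ≤ RQ ∧ ∀ j, Q j ⊆ Metric.closedBall 0 RQ := by
    have h : ∀ j, ∃ Rj : ℝ, Q j ⊆ Metric.closedBall 0 Rj := fun j => (hbd j).subset_closedBall 0
    choose Rj hRj using h
    refine ⟨∑ j, |Rj j|, Finset.sum_nonneg fun j _ => abs_nonneg _, fun j x hx => ?_⟩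
    have h1 : ‖x‖ ≤ Rj j := mem_closedBall_zero_iff.1 (hRj j hx)
    rw [mem_closedBall_zero_iff]
    calc ‖x‖ ≤ |Rj j| := h1.trans (le_abs_self _)
      _ ≤ ∑ j, |Rj j| := Finset.single_le_sum (fun j _ => abs_nonneg (Rj j)) (Finset.mem_univ j)
  obtain ⟨RQ, hRQ0, hRQ⟩ := hball
  -- the chimera neighbourhood and its points
  have hmemC : ∀ {r : ℝ} {x : EuclideanSpace ℝ (Fin 3)},
      x ∈ (⋃ f, ⋃ a ∈ S f, ⋃ q ∈ Q a, q +ᵥ (r • K f)) →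
        ∃ f, ∃ a ∈ S f, ∃ q ∈ Q a, ∃ w ∈ K f, x = q + r • w := by
    intro r x hx
    simp only [mem_iUnion, exists_prop] at hx
    obtain ⟨f, a, ha, q, hq, hxq⟩ := hx
    obtain ⟨v, hv, rfl⟩ := Set.mem_vadd_set.1 hxq
    obtain ⟨w, hw, rfl⟩ := Set.mem_smul_set.1 hv
    exact ⟨f, a, ha, q, hq, w, hw, rfl⟩
  have hCball : ∀ {r : ℝ}, 0 < r → r ≤ 1 → ∀ x ∈ (⋃ f, ⋃ a ∈ S f, ⋃ q ∈ Q a, q +ᵥ (r • K f)),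
      x ∈ Metric.closedBall (0 : EuclideanSpace ℝ (Fin 3)) (RQ + R) := by
    intro r hr hr1 x hx
    obtain ⟨f, a, -, q, hq, w, hw, rfl⟩ := hmemC hx
    have h1 : ‖q‖ ≤ RQ := mem_closedBall_zero_iff.1 (hRQ a hq)
    have h2 : ‖w‖ ≤ R := mem_closedBall_zero_iff.1 (hKR f hw)
    rw [mem_closedBall_zero_iff]
    calc ‖q + r • w‖ ≤ ‖q‖ + ‖r • w‖ := norm_add_le _ _
      _ = ‖q‖ + r * ‖w‖ := by rw [norm_smul, Real.norm_of_nonneg hr.le]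
      _ ≤ RQ + 1 * R := by gcongr
      _ = RQ + R := by ring
  -- the regions of the slab accounting
  obtain ⟨Areg, hAreg⟩ : ∃ Areg : ℝ → Fin k × Fin k → Set (EuclideanSpace ℝ (Fin 3)),
      ∀ r t, Areg r t = Q t.2 ∩ {x | (q₀ t).2 - r * hK t < ⟪(q₀ t).1, x⟫_ℝ} :=
    ⟨fun r t => Q t.2 ∩ {x | (q₀ t).2 - r * hK t < ⟪(q₀ t).1, x⟫_ℝ}, fun r t => rfl⟩
  obtain ⟨Preg, hPreg⟩ : ∃ Preg : ℝ → ((EuclideanSpace ℝ (Fin 3)) × ℝ) × ((EuclideanSpace ℝ (Fin 3)) × ℝ) →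
      Set (EuclideanSpace ℝ (Fin 3)), ∀ r pp, Preg r pp =
    {x | (pp.1.2 - r * (R + 1) < ⟪pp.1.1, x⟫_ℝ ∧ ⟪pp.1.1, x⟫_ℝ < pp.1.2 + r * (R + 1))} ∩
      {x | pp.2.2 - r * (R + 1) < ⟪pp.2.1, x⟫_ℝ ∧ ⟪pp.2.1, x⟫_ℝ < pp.2.2 + r * (R + 1)} ∩
      Metric.closedBall 0 (RQ + R) := ⟨fun r pp => _, fun r pp => rfl⟩
  -- the covering, as a set inclusion
  have hincl : ∀ {r : ℝ}, 0 < r → r ≤ 1 →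
      (⋃ f, ⋃ a ∈ S f, ⋃ q ∈ Q a, q +ᵥ (r • K f)) ⊆
        E' ∪ N ∪ (⋃ t ∈ Adj, Areg r t) ∪ (⋃ pp ∈ Pairs, Preg r pp) := by
    intro r hr hr1 x hx
    by_cases hxE : x ∈ E'
    · exact Or.inl (Or.inl (Or.inl hxE))
    by_cases hxN : x ∈ N
    · exact Or.inl (Or.inl (Or.inr hxN))
    have hxball := hCball hr hr1 x hx
    obtain ⟨f, a, ha, q, hq, w, hw, rfl⟩ := hmemC hx
    rcases hcover r hr hr1 f a ha q hq w hw hxE hxN with ⟨t, ht, htf, hxt, hslab⟩ | ⟨pp, hpp, h1, h2⟩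
    · refine Or.inl (Or.inr (mem_iUnion₂.2 ⟨t, ht, ?_⟩))
      rw [hAreg]
      refine ⟨hxt, ?_⟩
      show (q₀ t).2 - r * hK t < ⟪(q₀ t).1, q + r • w⟫_ℝ
      rw [hhK]; simp only; rw [htf]; exact hslab
    · refine Or.inr (mem_iUnion₂.2 ⟨pp, hpp, ?_⟩)
      rw [hPreg]
      refine ⟨⟨?_, ?_⟩, hxball⟩
      · rw [abs_le] at h1
        constructor <;> nlinarith [h1.1, h1.2, hr]
      · rw [abs_le] at h2
        constructor <;> nlinarith [h2.1, h2.2, hr]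
  -- ADJACENT TERMS: eventually `|Areg r t| ≤ r (hK t · fA t + (R+1) ε₁)`
  set ε₁ : ℝ := ε / (2 * (R + 1) * (Adj.card + 1)) with hε₁
  have hε₁0 : 0 < ε₁ := by positivity
  have hAdjev : ∀ t ∈ Adj, ∀ᶠ r in 𝓝[>] (0 : ℝ), (volume (Areg r t)).toReal ≤ r * (hK t * fA t + R * ε₁) ∧
      volume (Areg r t) ≠ ⊤ := by
    intro t ht
    obtain ⟨δ, hδ, hδs⟩ := volume_facetSlab_le (H t.2) (hbd t.2) (hne t.2) (hunit t.2) (hAdj t ht) hε₁0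
    have hfin : ∀ r, volume (Areg r t) ≠ ⊤ := fun r => by
      rw [hAreg]
      exact (lt_of_le_of_lt (measure_mono (inter_subset_left.trans (hRQ t.2))) measure_closedBall_lt_top).ne
    by_cases hh : hK t = 0
    · filter_upwards [self_mem_nhdsWithin] with r hr0
      have hr0' : 0 < r := hr0
      refine ⟨?_, hfin r⟩
      have hempty : Areg r t = ∅ := by
        rw [hAreg]
        ext x
        simp only [hh, mul_zero, sub_zero, mem_inter_iff, mem_setOf_eq, mem_empty_iff_false,
          iff_false, not_and, not_lt]
        intro hx
        exact (mem_iInter₂.1 hx (q₀ t) (hAdj t ht)).le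
      rw [hempty, measure_empty, ENNReal.toReal_zero]
      have := hhK0 t; have := hfA0 t
      positivity
    · have hpos : 0 < hK t := lt_of_le_of_ne (hhK0 t) (Ne.symm hh)
      have hev : ∀ᶠ r in 𝓝[>] (0 : ℝ), r * hK t < δ := by
        have hc : Continuous fun r : ℝ => r * hK t := continuous_id.mul continuous_const
        have h0 : (fun r : ℝ => r * hK t) 0 < δ := by simp [hδ]
        exact nhdsWithin_le_nhds ((hc.tendsto 0).eventually (gt_mem_nhds h0))
      filter_upwards [hev, self_mem_nhdsWithin] with r hr hr0
      have hr0' : 0 < r := hr0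
      refine ⟨?_, hfin r⟩
      have h := hδs (r * hK t) (mul_pos hr0' hpos) hr
      rw [hAreg]
      calc (volume (Q t.2 ∩ {x | (q₀ t).2 - r * hK t < ⟪(q₀ t).1, x⟫_ℝ})).toReal ≤ r * hK t * (fA t + ε₁) := h
        _ = r * (hK t * fA t + hK t * ε₁) := by ring
        _ ≤ r * (hK t * fA t + R * ε₁) := by
            have := hhKR t ht
            gcongr
  -- PAIR TERMS: eventually `|Preg r pp| ≤ r ε₂`
  set ε₂ : ℝ := ε / (2 * (Pairs.card + 1)) with hε₂
  have hε₂0 : 0 < ε₂ := by positivity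
  have hPairev : ∀ pp ∈ Pairs, ∀ᶠ r in 𝓝[>] (0 : ℝ), (volume (Preg r pp)).toReal ≤ r * ε₂ ∧
      volume (Preg r pp) ≠ ⊤ := by
    intro pp hpp
    obtain ⟨ha, ha', hplanes⟩ := hPairs pp hpp
    have hfin : ∀ r, volume (Preg r pp) ≠ ⊤ := fun r => by
      rw [hPreg]
      exact (lt_of_le_of_lt (measure_mono inter_subset_right) measure_closedBall_lt_top).ne
    by_cases hpar : pp.2.1 = pp.1.1 ∨ pp.2.1 = -pp.1.1
    · -- parallel distinct planes: the region is empty for small `r`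
      -- the signed offset of the second plane in terms of the first normal
      obtain ⟨σ, hσ1, hσ⟩ : ∃ σ : ℝ, (σ = 1 ∨ σ = -1) ∧ pp.2.1 = σ • pp.1.1 := by
        rcases hpar with h | h
        · exact ⟨1, Or.inl rfl, by rw [h, one_smul]⟩
        · exact ⟨-1, Or.inr rfl, by rw [h, neg_one_smul]⟩
      have hσσ : σ * σ = 1 := by rcases hσ1 with h | h <;> rw [h] <;> norm_num
      have hoff : pp.2.2 ≠ σ * pp.1.2 := by
        intro heq
        apply hplanes
        ext x
        simp only [mem_setOf_eq, hσ, real_inner_smul_left]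
        constructor
        · intro h; rw [h, heq]
        · intro h
          have : σ * (σ * ⟪pp.1.1, x⟫_ℝ) = σ * (σ * pp.1.2) := by rw [h, heq]
          rwa [← mul_assoc, ← mul_assoc, hσσ, one_mul, one_mul] at this
      have hd : 0 < |pp.2.2 - σ * pp.1.2| := abs_pos.2 (sub_ne_zero.2 hoff)
      have hev : ∀ᶠ r in 𝓝[>] (0 : ℝ), r * (2 * (R + 1)) < |pp.2.2 - σ * pp.1.2| := by
        have hc : Continuous fun r : ℝ => r * (2 * (R + 1)) := continuous_id.mul continuous_const
        have h0 : (fun r : ℝ => r * (2 * (R + 1))) 0 < |pp.2.2 - σ * pp.1.2| := by simp [hd]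
        exact nhdsWithin_le_nhds ((hc.tendsto 0).eventually (gt_mem_nhds h0))
      filter_upwards [hev, self_mem_nhdsWithin] with r hr hr0
      have hr0' : 0 < r := hr0
      refine ⟨?_, hfin r⟩
      have hempty : Preg r pp = ∅ := by
        rw [hPreg]
        ext x
        simp only [mem_inter_iff, mem_setOf_eq, mem_empty_iff_false, iff_false, not_and]
        intro h12 _
        obtain ⟨⟨h1a, h1b⟩, h2⟩ := h12
        rw [hσ, real_inner_smul_left] at h2
        obtain ⟨h2a, h2b⟩ := h2
        have hlt : |pp.2.2 - σ * pp.1.2| < r * (2 * (R + 1)) := by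
          rw [abs_lt]
          rcases hσ1 with hs | hs <;> rw [hs] at h2a h2b ⊢ <;> constructor <;> nlinarith
        linarith
      rw [hempty, measure_empty, ENNReal.toReal_zero]
      positivity
    · -- transversal planes: `O(r²)`
      push Not at hpar
      obtain ⟨C, hC0, hC⟩ := exists_volume_two_slabs_le ha ha' hpar.1 hpar.2 (RQ + R)
      have hev : ∀ᶠ r in 𝓝[>] (0 : ℝ), r * (C * (R + 1) ^ 2) ≤ ε₂ := by
        have hc : Continuous fun r : ℝ => r * (C * (R + 1) ^ 2) := continuous_id.mul continuous_const
        have h0 : (fun r : ℝ => r * (C * (R + 1) ^ 2)) 0 < ε₂ := by simp [hε₂0]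
        exact nhdsWithin_le_nhds (((hc.tendsto 0).eventually (gt_mem_nhds h0)).mono fun r hr => hr.le)
      filter_upwards [hev, self_mem_nhdsWithin] with r hr hr0
      have hr0' : 0 < r := hr0
      refine ⟨?_, hfin r⟩
      have h := hC pp.1.2 pp.2.2 (r * (R + 1)) (r * (R + 1)) (by positivity) (by positivity)
      have hset : Preg r pp = {x : EuclideanSpace ℝ (Fin 3) | pp.1.2 - r * (R + 1) < ⟪pp.1.1, x⟫_ℝ ∧
          ⟪pp.1.1, x⟫_ℝ < pp.1.2 + r * (R + 1)} ∩ {x | pp.2.2 - r * (R + 1) < ⟪pp.2.1, x⟫_ℝ ∧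
          ⟪pp.2.1, x⟫_ℝ < pp.2.2 + r * (R + 1)} ∩ Metric.closedBall 0 (RQ + R) := hPreg r pp
      rw [hset]
      calc (volume ({x : EuclideanSpace ℝ (Fin 3) | pp.1.2 - r * (R + 1) < ⟪pp.1.1, x⟫_ℝ ∧
            ⟪pp.1.1, x⟫_ℝ < pp.1.2 + r * (R + 1)} ∩ {x | pp.2.2 - r * (R + 1) < ⟪pp.2.1, x⟫_ℝ ∧
            ⟪pp.2.1, x⟫_ℝ < pp.2.2 + r * (R + 1)} ∩ Metric.closedBall 0 (RQ + R))).toReal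
          ≤ (ENNReal.ofReal (C * (r * (R + 1)) * (r * (R + 1)))).toReal :=
            ENNReal.toReal_mono ENNReal.ofReal_ne_top h
        _ = r * (r * (C * (R + 1) ^ 2)) := by rw [ENNReal.toReal_ofReal (by positivity)]; ring
        _ ≤ r * ε₂ := by gcongr
  -- collect the finitely many eventualities
  have hall : ∀ᶠ r in 𝓝[>] (0 : ℝ), r < 1 ∧
      (∀ t ∈ Adj, (volume (Areg r t)).toReal ≤ r * (hK t * fA t + R * ε₁) ∧ volume (Areg r t) ≠ ⊤) ∧
      (∀ pp ∈ Pairs, (volume (Preg r pp)).toReal ≤ r * ε₂ ∧ volume (Preg r pp) ≠ ⊤) := by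
    have h1 : ∀ᶠ r in 𝓝[>] (0 : ℝ), r < 1 := nhdsWithin_le_nhds (eventually_lt_nhds zero_lt_one)
    exact h1.and (((Adj.eventually_all).2 hAdjev).and ((Pairs.eventually_all).2 hPairev))
  obtain ⟨r₀, hr₀, hr₀sub⟩ := mem_nhdsGT_iff_exists_Ioo_subset.1 hall
  refine ⟨r₀, hr₀, fun r hr hrr₀ => ?_⟩
  obtain ⟨hr1, hAdjr, hPairr⟩ := hr₀sub ⟨hr, hrr₀⟩
  -- finiteness
  have hE'fin : volume E' ≠ ⊤ := by
    refine (lt_of_le_of_lt (measure_mono ?_) (measure_closedBall_lt_top (x := (0 : EuclideanSpace ℝ (Fin 3)))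
      (r := RQ))).ne
    intro x hx
    simp only [hE', mem_iUnion, exists_prop] at hx
    obtain ⟨f, a, -, hxa⟩ := hx
    exact hRQ a hxa
  have hAfin : volume (⋃ t ∈ Adj, Areg r t) ≠ ⊤ :=
    (lt_of_le_of_lt (measure_biUnion_finset_le Adj (Areg r))
      (ENNReal.sum_lt_top.2 fun t ht => lt_top_iff_ne_top.2 (hAdjr t ht).2)).ne
  have hPfin : volume (⋃ pp ∈ Pairs, Preg r pp) ≠ ⊤ :=
    (lt_of_le_of_lt (measure_biUnion_finset_le Pairs (Preg r))
      (ENNReal.sum_lt_top.2 fun pp hpp => lt_top_iff_ne_top.2 (hPairr pp hpp).2)).ne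
  -- the measure estimate
  have hle : volume (⋃ f, ⋃ a ∈ S f, ⋃ q ∈ Q a, q +ᵥ (r • K f)) ≤
      volume E' + volume N + volume (⋃ t ∈ Adj, Areg r t) + volume (⋃ pp ∈ Pairs, Preg r pp) := by
    calc volume (⋃ f, ⋃ a ∈ S f, ⋃ q ∈ Q a, q +ᵥ (r • K f))
        ≤ volume (E' ∪ N ∪ (⋃ t ∈ Adj, Areg r t) ∪ (⋃ pp ∈ Pairs, Preg r pp)) :=
          measure_mono (hincl hr hr1.le)
      _ ≤ volume (E' ∪ N ∪ (⋃ t ∈ Adj, Areg r t)) + volume (⋃ pp ∈ Pairs, Preg r pp) := measure_union_le _ _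
      _ ≤ volume (E' ∪ N) + volume (⋃ t ∈ Adj, Areg r t) + volume (⋃ pp ∈ Pairs, Preg r pp) := by
          gcongr; exact measure_union_le _ _
      _ ≤ volume E' + volume N + volume (⋃ t ∈ Adj, Areg r t) + volume (⋃ pp ∈ Pairs, Preg r pp) := by
          gcongr; exact measure_union_le _ _
  rw [hN, add_zero] at hle
  have hsumA : (volume (⋃ t ∈ Adj, Areg r t)).toReal ≤ ∑ t ∈ Adj, r * (hK t * fA t + R * ε₁) := by
    calc (volume (⋃ t ∈ Adj, Areg r t)).toReal ≤ (∑ t ∈ Adj, volume (Areg r t)).toReal :=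
          ENNReal.toReal_mono (ENNReal.sum_ne_top.2 fun t ht => (hAdjr t ht).2) (measure_biUnion_finset_le Adj (Areg r))
      _ = ∑ t ∈ Adj, (volume (Areg r t)).toReal := ENNReal.toReal_sum fun t ht => (hAdjr t ht).2
      _ ≤ ∑ t ∈ Adj, r * (hK t * fA t + R * ε₁) := Finset.sum_le_sum fun t ht => (hAdjr t ht).1
  have hsumP : (volume (⋃ pp ∈ Pairs, Preg r pp)).toReal ≤ ∑ pp ∈ Pairs, r * ε₂ := by
    calc (volume (⋃ pp ∈ Pairs, Preg r pp)).toReal ≤ (∑ pp ∈ Pairs, volume (Preg r pp)).toReal :=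
          ENNReal.toReal_mono (ENNReal.sum_ne_top.2 fun pp hpp => (hPairr pp hpp).2)
            (measure_biUnion_finset_le Pairs (Preg r))
      _ = ∑ pp ∈ Pairs, (volume (Preg r pp)).toReal := ENNReal.toReal_sum fun pp hpp => (hPairr pp hpp).2
      _ ≤ ∑ pp ∈ Pairs, r * ε₂ := Finset.sum_le_sum fun pp hpp => (hPairr pp hpp).1
  have htot : (volume (⋃ f, ⋃ a ∈ S f, ⋃ q ∈ Q a, q +ᵥ (r • K f))).toReal ≤
      (volume E').toReal + (volume (⋃ t ∈ Adj, Areg r t)).toReal + (volume (⋃ pp ∈ Pairs, Preg r pp)).toReal := by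
    have h := ENNReal.toReal_mono (ENNReal.add_ne_top.2 ⟨ENNReal.add_ne_top.2 ⟨hE'fin, hAfin⟩, hPfin⟩) hle
    rwa [ENNReal.toReal_add (ENNReal.add_ne_top.2 ⟨hE'fin, hAfin⟩) hPfin,
      ENNReal.toReal_add hE'fin hAfin] at h
  -- bookkeeping of the `ε`'s
  have hsum1 : ∑ t ∈ Adj, r * (hK t * fA t + R * ε₁) =
      r * (∑ t ∈ Adj, hK t * fA t) + r * (Adj.card * (R * ε₁)) := by
    rw [← Finset.mul_sum, Finset.sum_add_distrib, Finset.sum_const, nsmul_eq_mul, mul_add]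
  have hsum2 : ∑ pp ∈ Pairs, r * ε₂ = r * (Pairs.card * ε₂) := by
    rw [Finset.sum_const, nsmul_eq_mul]; ring
  have hb1 : (Adj.card : ℝ) * (R * ε₁) ≤ ε / 2 := by rw [hε₁]; exact card_mul_eps_le hR hε.le _
  have hb2 : (Pairs.card : ℝ) * ε₂ ≤ ε / 2 := by rw [hε₂]; exact card_mul_eps_le' hε.le _
  rw [hsum1] at hsumA
  rw [hsum2] at hsumP
  have hc1 : r * (Adj.card * (R * ε₁)) ≤ r * (ε / 2) := mul_le_mul_of_nonneg_left hb1 hr.le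
  have hc2 : r * (Pairs.card * ε₂) ≤ r * (ε / 2) := mul_le_mul_of_nonneg_left hb2 hr.le
  linarith only [hsumA, hsumP, htot, hc1, hc2]

end Summit.Ventures.Crystal3D.Theorems

end
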